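import Literature.NumberTheory.EllipticCurves.XCubeSub81675ShaThree
import Literature.NumberTheory.NumberFields.EisensteinFieldSelmerTwoInert
import HarnessLib

/-!
# Jeong's family `A_{pq} : y² = x³ + (pq)²`, `p ≠ q` primes `≡ 2 (mod 3)`: the `√−3`-Selmer group over `ℚ(ζ₃)` lies in
# the box `⟨[2],[p],[q]⟩`; `rank A_{pq}(ℚ) ≤ 2` unconditionally; sharpness criterion for `Ш[3] = 0` and `rank = 2`

Topic `NumberTheory/EllipticCurves`. Parametric version of `XCubeSub81675ThreeDescentSelmer.lean` /
`XCubeSub81675ShaThree.lean` (the case `p = 5`, `q = 11`). For distinct odd primes `p, q ≡ 2 (mod 3)` put `t = pq`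
and consider over `K3 = ℚ(ζ₃)`, `θ = √−3`:

  `A : Y² = X³ + (3tθ)² = X³ − 27t²` (`= E_D`, `D = −3c²`, `c = 3t`), `A' = E_{81c²} : Y² = X³ + (27t)²`,
  the `μ₃`-torsor classes `[C_a] ∈ H¹(K3, A)` (kernel point `T = (0, 3tθ)`), the descent map
  `δ = phiDescent (3t) : A'(·) → ·`, `(X, Y) ↦ Y + 27t`, and the complex multiplication `f = [√−3] ∈ End_{K3}(A)`.

Over `ℚ`: `A' ≅ A_t : y² = x³ + t²` (`u = 1/3`) — Jeong's `A_{pq}` (Proc. Japan Acad. 95 (2019), §3) — and `A` is its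
`−3`-twist, `3`-isogenous to it.

* §1 `f ∘ f = [−3]`, `ker f = {O, ±T}`, `f` onto (as in the `55` file, for general `t`).
* §2 **The Selmer box** (`MordellPQ.exists_cubeClass_eq_of_sha`): if `[C_a] ∈ Ш(A/K3)` then
  `[a] = [2^k p^l q^m]`, `k, l, m < 3` — local necessity (`MordellCurveThreeDescentLocalConverse`) at the completions:
  `3 ∣ ord_v(a)` for `v ∤ 6pq` and at `λ` (`ord_λ(54t) = 6`), `χ₂(a) = 0` (`27t` is a `2`-unit; the character extended
  to `K3_2` by density, `MordellCurveCubicDescentLocalCompletion`); then `K(S,3)` for `S = {λ,2,p,q}`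
  (`EisensteinFieldSelmerTwoInert`). This is Jeong's Lemma 3.3 / Prop. 3.5 (`im α ≤ ⟨2,p,q⟩`, `ζ₃ ∉ Sel`) read jointly
  over `K3` and for Selmer CLASSES.
* §3 **`rank A_{pq}(ℚ) ≤ 2` for ALL such `p, q`** (`MordellPQ.mordellWeilRank_le_two`): the descent classes of `A'(K3)`
  lie in the box (their torsor classes vanish), the box has `27` elements (valuations at `2, p, q`), and
  `#δ(A'(K3)) = 3^{rank A'(ℚ)+1}` (`natCard_range_cubicDescentClass_eq`); `A_t ≅ A'` over `ℚ`.
* §4 **Sharpness criterion** (`MordellPQ.sha_three_of_generators`): if `[2], [p], [q]` are descent classes of points of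
  `A'(K3)` (three rational points usually provide them), then `Ш(A/K3) ∩ ker f_* = 0`, `Ш(A/K3)[3] = 0`,
  `Ш(E/ℚ)[3^∞] = 0` and `corank_{ℤ₃} Ш = 0` for `E : y² = x³ − 27t²`, and `rank A_t(ℚ) = rank E(ℚ) = 2`.

## References

* [Jeong2019RankExactlyTwoII] K. Jeong, Proc. Japan Acad. Ser. A 95 (2019) 53–57, §3, Lemma 3.3, Prop. 3.5.
* [CohenPazuki2009] H. Cohen, F. Pazuki, Acta Arith. 140 (2009) 369–404, Thm. 2.1, §5.
* [SilvermanAEC2009] J. H. Silverman, *AEC* 2nd ed., Thm. X.4.2, Remark X.4.7, Prop. X.4.9, Exercise 10.9.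
* [Greenberg1999LNM] R. Greenberg, LNM 1716 (1999), §1.
-/

noncomputable section

open scoped Classical WithZero

open WeierstrassCurve IsDedekindDomain IsDedekindDomain.HeightOneSpectrum NumberField
open WithZero (log exp)
open Literature.NumberTheory.NumberFields Literature.NumberTheory.NumberFields.K3
open Literature.NumberTheory.GaloisRepresentations

namespace Literature.NumberTheory.EllipticCurves

namespace MordellPQ

variable {p q : ℕ} [hpp : Fact p.Prime] [hqp : Fact q.Prime]

/-! ## §0 The parameters: `t = pq`, `c = 3t`, `B_A = 3tθ` -/

/-- `t = pq ≠ 0` in `K3`. [folklore] -/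
private theorem t_ne_zero : ((p * q : ℕ) : K3) ≠ 0 := by
  exact_mod_cast (Nat.mul_ne_zero hpp.out.ne_zero hqp.out.ne_zero)

/-- `c = 3t ≠ 0` in `K3` (the parameter of `A = E_{−3c²}`). [cite: Jeong2019RankExactlyTwoII, §3] -/
theorem hc : ((3 * (p * q) : ℕ) : K3) ≠ 0 := by
  exact_mod_cast (Nat.mul_ne_zero (by norm_num) (Nat.mul_ne_zero hpp.out.ne_zero hqp.out.ne_zero))

/-- `B_A = 3tθ ≠ 0`. [cite: Jeong2019RankExactlyTwoII, §3] -/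
theorem hBA : ((3 * (p * q) : ℕ) : K3) * theta ≠ 0 :=
  mul_ne_zero hc fun h => by
    have := theta_sq; rw [h] at this; norm_num at this

omit hpp hqp in
/-- `A = E_D`, `D = B_A² = −3c²`. [cite: Jeong2019RankExactlyTwoII, §3] -/
theorem hD : (((3 * (p * q) : ℕ) : K3) * theta) ^ 2 = -3 * ((3 * (p * q) : ℕ) : K3) ^ 2 := by
  rw [mul_pow, theta_sq]; ring

/-! ## §1 `f = [√−3]` on `A`: `f ∘ f = [−3]`, kernel, surjectivity -/

/-- **`f ∘ f = [−3]`** on `A(K̄)` (`σ = ` complex conjugation: `σθ = −θ`, `σB_A = −B_A`). [cite: SilvermanAEC2009, Cor. III.6.3] -/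
theorem f_comp_self (P : (mordellCurve ((((3 * (p * q) : ℕ) : K3) * theta) ^ 2)).geomPoints) :
    (SqrtThree.sqrtThree hBA theta_sq) ((SqrtThree.sqrtThree hBA theta_sq) P) = -((3 : ℤ) • P) := by
  refine SqrtThree.sqrtThree_comp_self' conjBar conjBar_theta ?_ hBA theta_sq P
  rw [map_mul, map_mul, conjBar_theta, mul_neg]
  congr 1
  have : (((3 * (p * q) : ℕ) : ℚ) : K3) = ((3 * (p * q) : ℕ) : K3) := by push_cast; ring
  rw [← this, conjBar_ratCast]

/-- **`ker f ⊆ {O, ±T}`**, `T = (0, 3tθ)`. [cite: CohenPazuki2009, Thm. 2.1] -/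
theorem f_ker (P : (mordellCurve ((((3 * (p * q) : ℕ) : K3) * theta) ^ 2)).geomPoints)
    (h0 : (SqrtThree.sqrtThree hBA theta_sq) P = 0) :
    P = 0 ∨ P = MordellDescent.torsT hc hD ∨ P = -MordellDescent.torsT hc hD := by
  rcases P with _ | ⟨x, y, hxy⟩
  · exact Or.inl rfl
  · have hx : x = 0 := SqrtThree.sqrtThree_eq_zero_imp hBA theta_sq hxy h0
    exact Or.inr ((MordellDescent.isVeluThreePair_mordell hc hD).some_eq_T_or hxy hx)

/-- `f` is onto `A(K̄)`. [cite: SilvermanAEC2009, Thm. II.2.3] -/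
theorem f_surjective : Function.Surjective (SqrtThree.sqrtThree (hBA (p := p) (q := q)) theta_sq).toAddMonoidHom := by
  haveI := isElliptic_mordellCurve (pow_ne_zero 2 (hBA (p := p) (q := q)))
  exact Isogeny.surjective _

/-! ## §2 The Selmer box: local conditions necessary for `[C_a] ∈ Ш(A/K3)` -/

/-- The valuation of `K3_v` restricts to `v` on `K3`. [folklore] -/
private theorem v_algebraMap (v : HeightOneSpectrum (𝓞 K3)) (x : K3) :
    Valued.v (algebraMap K3 (v.adicCompletion K3) x) = v.valuation K3 x :=
  valuedAdicCompletion_eq_valuation' v x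

omit hpp hqp in
/-- `54t = 2·3³·pq ∉ 𝔭_v` for `v ∤ 6pq`. [folklore] -/
private theorem natCast_54t_not_mem {v : HeightOneSpectrum (𝓞 K3)} (hv : (6 * p * q : 𝓞 K3) ∉ v.asIdeal) :
    ((54 * (p * q) : ℕ) : 𝓞 K3) ∉ v.asIdeal := by
  intro h
  have h6 : (6 * p * q : 𝓞 K3) = 3 * (2 * p * q) := by ring
  have h' : (3 : 𝓞 K3) * (3 * (6 * p * q)) ∈ v.asIdeal := by
    have e : (3 : 𝓞 K3) * (3 * (6 * p * q)) = ((54 * (p * q) : ℕ) : 𝓞 K3) := by push_cast; ring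
    rw [e]; exact h
  have h3 : (3 : 𝓞 K3) ∈ v.asIdeal → False := fun h3 =>
    hv (by rw [h6]; exact v.asIdeal.mul_mem_right _ h3)
  rcases v.isPrime.mem_or_mem h' with h3' | h''
  · exact h3 h3'
  · rcases v.isPrime.mem_or_mem h'' with h3' | h330'
    · exact h3 h3'
    · exact hv h330'

/-- `χ₂` is a level-one residue character for `val₂` on `K3`. [cite: IrelandRosen1990, Ch. 9 §3] -/
private theorem isResidueChar_chi2' : MordellDescent.IsResidueChar (val prime_natCast_two) chi2 :=
  ⟨fun hx hy ↦ chi_mul _ cubicChar_mul_two hx hy, fun h ↦ chi_eq_of_val_sub_lt _ h,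
    chi_neg_one _ cubicChar_ratCast_two⟩

/-- In a `K3`-algebra `L`: `9 · c = 27t` and `2 · 9 · c = 54t` through `algebraMap`, and `9c ≠ 0` (in characteristic `0`).
[folklore] -/
private theorem algebraMap_facts (L : Type) [Field L] [Algebra K3 L] :
    (9 : L) * algebraMap K3 L ((3 * (p * q) : ℕ) : K3) = algebraMap K3 L ((27 * (p * q) : ℕ) : K3) ∧
      (2 : L) * (9 * algebraMap K3 L ((3 * (p * q) : ℕ) : K3)) = algebraMap K3 L ((54 * (p * q) : ℕ) : K3) ∧
      (9 : L) * algebraMap K3 L ((3 * (p * q) : ℕ) : K3) ≠ 0 := by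
  haveI : CharZero L := charZero_of_injective_algebraMap (algebraMap K3 L).injective
  refine ⟨?_, ?_, ?_⟩
  · rw [map_natCast, map_natCast]; push_cast; ring
  · rw [map_natCast, map_natCast]; push_cast; ring
  · rw [map_natCast]
    exact_mod_cast (Nat.mul_ne_zero (by norm_num) (Nat.mul_ne_zero (by norm_num)
      (Nat.mul_ne_zero hpp.out.ne_zero hqp.out.ne_zero)))

section Local

variable (hp3 : p % 3 = 2) (hq3 : q % 3 = 2) (hp2 : p ≠ 2) (hq2 : q ≠ 2)
variable {a : K3} (ha : a ≠ 0)
  (hsha : MordellDescent.torsorClass hc hD ha ∈ (mordellCurve ((((3 * (p * q) : ℕ) : K3) * theta) ^ 2)).sha)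
include hsha

/-- **At the places `v ∤ 6pq`: `3 ∣ ord_v(a)`** (`ord_v(54t) = 0`). [cite: CohenPazuki2009, Thm. 2.1] -/
theorem three_dvd_log_valuation_of_sha (v : HeightOneSpectrum (𝓞 K3)) (hv : (6 * p * q : 𝓞 K3) ∉ v.asIdeal) :
    (3 : ℤ) ∣ log (v.valuation K3 a) := by
  set L := v.adicCompletion K3 with hL
  haveI : CharZero L := charZero_of_injective_algebraMap (algebraMap K3 L).injective
  obtain ⟨P, w, hw, hδ⟩ :=
    MordellDescent.exists_phiDescent_eq_adicCompletion_of_torsorClass_mem_sha hc hD ha hsha v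
  obtain ⟨-, h54, hcL⟩ := algebraMap_facts (p := p) (q := q) L
  have haL : algebraMap K3 L a ≠ 0 := (map_ne_zero (algebraMap K3 L)).mpr ha
  have hW : mordellCurve (81 * algebraMap K3 L ((3 * (p * q) : ℕ) : K3) ^ 2) =
      mordellCurve ((9 * algebraMap K3 L ((3 * (p * q) : ℕ) : K3)) ^ 2) := by
    congr 1; ring
  have hv54 : (3 : ℤ) ∣ log (Valued.v ((2 : L) * (9 * algebraMap K3 L ((3 * (p * q) : ℕ) : K3)))) := by
    rw [h54, v_algebraMap, ← coe_natCast_ringOfIntegers,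
      valuation_coe_eq_one v (natCast_54t_not_mem hv), WithZero.log_one]
    exact dvd_zero 3
  have key := (Valued.v (R := L)).three_dvd_log_cubicDescent_of_dvd hW hcL two_ne_zero hv54 P
  rw [← MordellDescent.phiDescent_eq_cubicDescent, hδ, Valuation.log_map_mul _ haL (pow_ne_zero 3 hw),
    Valuation.log_map_pow, v_algebraMap] at key
  have : (3 : ℤ) ∣ log (v.valuation K3 a) + 3 * log (Valued.v w) := key
  omega

include hp3 hq3 in
/-- At `λ`: `3 ∣ ord_λ(a)` (`ord_λ(54t) = ord_λ(27) = 6`, `3 ∤ 2pq`). [cite: CohenPazuki2009, Thm. 2.1 and §5] -/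
private theorem three_dvd_log_vL_of_sha_pq : (3 : ℤ) ∣ log (vL a) := by
  set v : HeightOneSpectrum (𝓞 K3) := placeOfPrime prime_lamInt with hvdef
  set L := v.adicCompletion K3 with hL
  haveI : CharZero L := charZero_of_injective_algebraMap (algebraMap K3 L).injective
  obtain ⟨P, w, hw, hδ⟩ :=
    MordellDescent.exists_phiDescent_eq_adicCompletion_of_torsorClass_mem_sha hc hD ha hsha v
  obtain ⟨-, h54, hcL⟩ := algebraMap_facts (p := p) (q := q) L
  have haL : algebraMap K3 L a ≠ 0 := (map_ne_zero (algebraMap K3 L)).mpr ha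
  have hW : mordellCurve (81 * algebraMap K3 L ((3 * (p * q) : ℕ) : K3) ^ 2) =
      mordellCurve ((9 * algebraMap K3 L ((3 * (p * q) : ℕ) : K3)) ^ 2) := by
    congr 1; ring
  have h2pq : ¬ 3 ∣ 2 * (p * q) := by
    intro h
    rcases (Nat.Prime.dvd_mul Nat.prime_three).mp h with h | h
    · omega
    · rcases (Nat.Prime.dvd_mul Nat.prime_three).mp h with h | h <;> omega
  have hv54 : (3 : ℤ) ∣ log (Valued.v ((2 : L) * (9 * algebraMap K3 L ((3 * (p * q) : ℕ) : K3)))) := by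
    rw [h54, v_algebraMap, show ((54 * (p * q) : ℕ) : K3) = 3 ^ 3 * ((2 * (p * q) : ℕ) : K3) by push_cast; ring,
      Valuation.log_map_mul _ (by norm_num) (by exact_mod_cast (Nat.mul_ne_zero two_ne_zero
        (Nat.mul_ne_zero hpp.out.ne_zero hqp.out.ne_zero))),
      Valuation.log_map_pow]
    change (3 : ℤ) ∣ 3 * log (vL 3) + log (vL ((2 * (p * q) : ℕ) : K3))
    rw [vL_three, WithZero.log_exp, log_val_lam_natCast h2pq]
    norm_num
  have key := (Valued.v (R := L)).three_dvd_log_cubicDescent_of_dvd hW hcL two_ne_zero hv54 P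
  rw [← MordellDescent.phiDescent_eq_cubicDescent, hδ, Valuation.log_map_mul _ haL (pow_ne_zero 3 hw),
    Valuation.log_map_pow, v_algebraMap] at key
  have : (3 : ℤ) ∣ log (vL a) + 3 * log (Valued.v w) := key
  omega

include hp2 hq2 in
/-- At `2`: `χ₂(a) = 0` (`27t` is a `2`-unit since `p, q` are odd; `ord_2(54t) = 1`; the character extended to
`K3_2` by density kills the local descent value). [cite: CohenPazuki2009, §5] [cite: Jeong2019RankExactlyTwoII, Lemma 3.4 (iii)] -/
private theorem chi2_eq_zero_of_sha_pq : chi2 a = 0 := by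
  set v : HeightOneSpectrum (𝓞 K3) := placeOfPrime prime_natCast_two with hvdef
  set L := v.adicCompletion K3 with hL
  haveI : CharZero L := charZero_of_injective_algebraMap (algebraMap K3 L).injective
  obtain ⟨P, w, hw, hδ⟩ :=
    MordellDescent.exists_phiDescent_eq_adicCompletion_of_torsorClass_mem_sha hc hD ha hsha v
  obtain ⟨χL, hχL, hχLK⟩ := isResidueChar_chi2'.exists_isResidueChar_extension (L := L)
    (fun y => v_algebraMap v y) (denseRange_algebraMap K3 v)
  obtain ⟨h27, h54, hcL⟩ := algebraMap_facts (p := p) (q := q) L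
  have haL : algebraMap K3 L a ≠ 0 := (map_ne_zero (algebraMap K3 L)).mpr ha
  have hW : mordellCurve (81 * algebraMap K3 L ((3 * (p * q) : ℕ) : K3) ^ 2) =
      mordellCurve ((9 * algebraMap K3 L ((3 * (p * q) : ℕ) : K3)) ^ 2) := by
    congr 1; ring
  have R := cubicChar_ratCast_two
  have hχB : χL ((9 : L) * algebraMap K3 L ((3 * (p * q) : ℕ) : K3)) = 0 := by
    rw [h27, hχLK]; exact chi_natCast _ R _
  have hχ2B : χL ((2 : L) * (9 * algebraMap K3 L ((3 * (p * q) : ℕ) : K3))) = 0 := by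
    rw [h54, hχLK]; exact chi_natCast _ R _
  have hp' : ¬ 2 ∣ p := fun h => hp2 ((Nat.prime_dvd_prime_iff_eq Nat.prime_two hpp.out).mp h).symm
  have hq' : ¬ 2 ∣ q := fun h => hq2 ((Nat.prime_dvd_prime_iff_eq Nat.prime_two hqp.out).mp h).symm
  have h27odd : ¬ 2 ∣ 27 * (p * q) := by
    intro h
    rcases (Nat.Prime.dvd_mul Nat.prime_two).mp h with h | h
    · omega
    · rcases (Nat.Prime.dvd_mul Nat.prime_two).mp h with h | h
      · exact hp' h
      · exact hq' h
  have hvB : Valued.v ((9 : L) * algebraMap K3 L ((3 * (p * q) : ℕ) : K3)) = 1 := by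
    rw [h27, v_algebraMap]; exact val_natCast_of_not_dvd prime_natCast_two h27odd
  have hv2B : Valued.v ((2 : L) * (9 * algebraMap K3 L ((3 * (p * q) : ℕ) : K3))) = exp (-1) := by
    rw [h54, v_algebraMap, show ((54 * (p * q) : ℕ) : K3) = ((2 : ℕ) : K3) * ((27 * (p * q) : ℕ) : K3) by push_cast; ring,
      Valuation.map_mul]
    change val prime_natCast_two _ * val prime_natCast_two _ = _
    rw [val_natCast_self, val_natCast_of_not_dvd prime_natCast_two h27odd, mul_one]
  have hwin : ∀ n : ℤ, log (Valued.v ((2 : L) * (9 * algebraMap K3 L ((3 * (p * q) : ℕ) : K3)))) ≤ n →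
      n ≤ log (Valued.v ((9 : L) * algebraMap K3 L ((3 * (p * q) : ℕ) : K3))) → (3 : ℤ) ∣ n →
      n = log (Valued.v ((9 : L) * algebraMap K3 L ((3 * (p * q) : ℕ) : K3))) ∧
        Valued.v ((2 : L) * (9 * algebraMap K3 L ((3 * (p * q) : ℕ) : K3))) <
          Valued.v ((9 : L) * algebraMap K3 L ((3 * (p * q) : ℕ) : K3)) := by
    intro n h1 h2 h3
    rw [hv2B, WithZero.log_exp] at h1
    rw [hvB, WithZero.log_one] at h2 ⊢
    refine ⟨by omega, ?_⟩
    rw [hv2B, ← WithZero.exp_zero]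
    exact WithZero.exp_lt_exp.mpr (by norm_num)
  have key := hχL.apply_cubicDescent_eq_zero hW hcL two_ne_zero hχB hχ2B hwin P
  rw [← MordellDescent.phiDescent_eq_cubicDescent, hδ, hχL.map_mul haL (pow_ne_zero 3 hw),
    hχL.map_pow_three hw, add_zero, hχLK] at key
  exact key

include hp3 hq3 hp2 hq2 in
/-- **The local conditions at `λ` and at `2`** for `[C_a] ∈ Ш(A/K3)`: `3 ∣ ord_λ(a)` (`ord_λ(54t) = 6`) and
`χ₂(a) = 0` (`27t` a `2`-unit, `ord_2(54t) = 1`, the cubic residue character extended to `K3_2` by density).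
[cite: CohenPazuki2009, Thm. 2.1 and §5] [cite: Jeong2019RankExactlyTwoII, Lemma 3.4 (iii)] -/
theorem local_conditions_of_sha : (3 : ℤ) ∣ log (vL a) ∧ chi2 a = 0 :=
  ⟨three_dvd_log_vL_of_sha_pq hp3 hq3 ha hsha, chi2_eq_zero_of_sha_pq hp2 hq2 ha hsha⟩

include hp3 hq3 hp2 hq2 in
/-- **The `√−3`-Selmer box for `A_{pq}`.** If `[C_a] ∈ Ш(A/K3)` then `[a] = [2^k p^l q^m]` in `K3ˣ/K3ˣ³` for some
`k, l, m < 3` (Jeong's Lemma 3.3 / Prop. 3.5, read for Selmer classes over `K3`).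
[cite: Jeong2019RankExactlyTwoII, Lemma 3.3 and Prop. 3.5] [cite: CohenPazuki2009, Thm. 2.1] -/
theorem exists_cubeClass_eq_of_sha :
    ∃ k l m : ℕ, k < 3 ∧ l < 3 ∧ m < 3 ∧
      MordellDescent.cubeClass a = MordellDescent.cubeClass (((2 ^ k * p ^ l * q ^ m : ℚ)) : K3) := by
  obtain ⟨s, i, j, k, l, m, w, hs, hi, hj, hk, hl, hm, hw, hnf⟩ :=
    exists_normal_form_twoInert hp3 hq3 ha (fun v hv => three_dvd_log_valuation_of_sha ha hsha v hv)
  have hj0 : j = 0 := j_eq_zero_of_dvd_twoInert hp3 hq3 hs i j k l m hw hj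
    (by rw [← hnf]; exact three_dvd_log_vL_of_sha_pq hp3 hq3 ha hsha)
  have hi0 : i = 0 := by
    have h := chi2_eq_zero_of_sha_pq hp2 hq2 ha hsha
    rw [hnf, hj0, pow_zero, mul_one, chi2_normalForm_twoInert hs i k l m hw] at h
    exact Nat.eq_zero_of_dvd_of_lt ((ZMod.natCast_eq_zero_iff i 3).mp h) hi
  refine ⟨k, l, m, hk, hl, hm, ?_⟩
  rw [hnf, hj0, hi0]
  exact cubeClass_normalForm_twoInert_of_i_j_eq_zero hs k l m hw

end Local

/-! ## §3 The descent classes of `A'(K3)` lie in the box; `rank A_{pq}(ℚ) ≤ 2` -/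

section Rank

variable (hp3 : p % 3 = 2) (hq3 : q % 3 = 2) (hp2 : p ≠ 2) (hq2 : q ≠ 2) (hpq : p ≠ q)

/-- Transport of the range of descent classes along an equality of curves. [folklore] -/
private theorem range_cubicDescentClass_congr {F : Type} [Field F] {W₁ W₂ : WeierstrassCurve F} (h : W₁ = W₂)
    (B : F) : Set.range (MordellDescent.cubicDescentClass W₁ B) = Set.range (MordellDescent.cubicDescentClass W₂ B) := by
  subst h; rfl

omit hpp hqp in
/-- The descent classes of `A'(K3)` as classes of `phiDescent (3t)` and as the count theorem's
`cubicDescentClass (9·3t)`: the same set. [folklore] -/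
private theorem range_eq_range :
    Set.range (fun P : (mordellCurve (81 * ((3 * (p * q) : ℕ) : K3) ^ 2)).toAffine.Point =>
        MordellDescent.cubeClass (MordellDescent.phiDescent ((3 * (p * q) : ℕ) : K3) P)) =
      Set.range (MordellDescent.cubicDescentClass (mordellCurve ((9 * ((3 * (p * q) : ℕ) : K3)) ^ 2))
        (9 * ((3 * (p * q) : ℕ) : K3))) := by
  have hcurve : mordellCurve (81 * ((3 * (p * q) : ℕ) : K3) ^ 2) = mordellCurve ((9 * ((3 * (p * q) : ℕ) : K3)) ^ 2) := by
    congr 1; ring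
  rw [← range_cubicDescentClass_congr hcurve]
  congr 1
  funext P
  exact MordellDescent.cubeClass_phiDescent _ P

/-- `[x^k] = [x^{k mod 3}]`. [folklore] -/
private theorem cubeClass_pow_mod {x : K3} (hx : x ≠ 0) (k : ℕ) :
    MordellDescent.cubeClass (x ^ k) = MordellDescent.cubeClass (x ^ (k % 3)) := by
  conv_lhs => rw [← Nat.mod_add_div k 3, pow_add, pow_mul, ← mul_comm]
  rw [mul_comm, show (x ^ 3) ^ (k / 3) = (x ^ (k / 3)) ^ 3 by ring,
    MordellDescent.cubeClass_mul_pow_three (pow_ne_zero _ hx) (pow_ne_zero _ hx)]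

include hp3 hq3 hp2 hq2 in
/-- **Every descent class of `A'(K3)` lies in the box `{[2^k p^l q^m] : k, l, m < 3}`** (its torsor class is
trivial, `torsorClass_phiDescent`). [cite: Jeong2019RankExactlyTwoII, Lemma 3.3] -/
theorem range_subset_box :
    Set.range (MordellDescent.cubicDescentClass (mordellCurve ((9 * ((3 * (p * q) : ℕ) : K3)) ^ 2))
        (9 * ((3 * (p * q) : ℕ) : K3))) ⊆
      Set.range (fun klm : Fin 3 × Fin 3 × Fin 3 =>
        MordellDescent.cubeClass ((2 : K3) ^ (klm.1 : ℕ) * (p : K3) ^ (klm.2.1 : ℕ) * (q : K3) ^ (klm.2.2 : ℕ))) := by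
  rw [← range_eq_range]
  rintro _ ⟨P, rfl⟩
  have ha := MordellDescent.phiDescent_ne_zero hc P
  have hsha : MordellDescent.torsorClass hc hD ha ∈ (mordellCurve ((((3 * (p * q) : ℕ) : K3) * theta) ^ 2)).sha := by
    rw [MordellDescent.torsorClass_phiDescent hc hD P]; exact AddSubgroup.zero_mem _
  obtain ⟨k, l, m, hk, hl, hm, h⟩ := exists_cubeClass_eq_of_sha hp3 hq3 hp2 hq2 ha hsha
  refine ⟨(⟨k, hk⟩, ⟨l, hl⟩, ⟨m, hm⟩), ?_⟩
  change MordellDescent.cubeClass ((2 : K3) ^ k * (p : K3) ^ l * (q : K3) ^ m) =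
    MordellDescent.cubeClass (MordellDescent.phiDescent ((3 * (p * q) : ℕ) : K3) P)
  rw [h]
  congr 1
  push_cast; ring

include hp3 hq3 hp2 hq2 hpq in
/-- **The box classes are distinct**: `(k, l, m) ↦ [2^k p^l q^m]` is injective on `{0,1,2}³` (valuations at `2, p, q`).
[cite: CohenPazuki2009, Thm. 2.1] -/
theorem box_injective : Function.Injective (fun klm : Fin 3 × Fin 3 × Fin 3 =>
    MordellDescent.cubeClass ((2 : K3) ^ (klm.1 : ℕ) * (p : K3) ^ (klm.2.1 : ℕ) * (q : K3) ^ (klm.2.2 : ℕ))) := by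
  rintro ⟨k, l, m⟩ ⟨k', l', m'⟩ h
  have hp0 : (p : K3) ≠ 0 := natCast_ne_zero (p := p)
  have hq0 : (q : K3) ≠ 0 := natCast_ne_zero (p := q)
  have hne : ∀ a b e : ℕ, (2 : K3) ^ a * (p : K3) ^ b * (q : K3) ^ e ≠ 0 := fun a b e =>
    mul_ne_zero (mul_ne_zero (pow_ne_zero _ two_ne_zero) (pow_ne_zero _ hp0)) (pow_ne_zero _ hq0)
  obtain ⟨w, hw, hww⟩ := (MordellDescent.cubeClass_eq_cubeClass_iff (hne _ _ _) (hne _ _ _)).mp h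
  have hnf : ∀ (a b e : ℕ) (z : K3), (2 : K3) ^ a * (p : K3) ^ b * (q : K3) ^ e * z ^ 3 =
      ((1 : ℤ) : K3) * zeta ^ 0 * (zeta - 1) ^ 0 * 2 ^ a * (p : K3) ^ b * (q : K3) ^ e * z ^ 3 := by
    intro a b e z; push_cast; ring
  have hlhs : (2 : K3) ^ (k : ℕ) * (p : K3) ^ (l : ℕ) * (q : K3) ^ (m : ℕ) =
      ((1 : ℤ) : K3) * zeta ^ 0 * (zeta - 1) ^ 0 * 2 ^ (k : ℕ) * (p : K3) ^ (l : ℕ) * (q : K3) ^ (m : ℕ) * 1 ^ 3 := by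
    push_cast; ring
  have h2 := congrArg (fun x => log (val prime_natCast_two x)) hww
  have h5 := congrArg (fun x => log (val (prime_natCast_of_inert p hp3) x)) hww
  have h11 := congrArg (fun x => log (val (prime_natCast_of_inert q hq3) x)) hww
  simp only at h2 h5 h11
  rw [hlhs, hnf, log_val2_normalForm_twoInert hp2 hq2 (Or.inl rfl) 0 0 _ _ _ one_ne_zero,
    log_val2_normalForm_twoInert hp2 hq2 (Or.inl rfl) 0 0 _ _ _ hw, Valuation.map_one, WithZero.log_one] at h2
  rw [hlhs, hnf, log_valp_normalForm_twoInert hp3 hp2 hpq (Or.inl rfl) 0 0 _ _ _ one_ne_zero,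
    log_valp_normalForm_twoInert hp3 hp2 hpq (Or.inl rfl) 0 0 _ _ _ hw, Valuation.map_one, WithZero.log_one] at h5
  rw [hlhs, hnf, log_valq_normalForm_twoInert hq3 hq2 hpq (Or.inl rfl) 0 0 _ _ _ one_ne_zero,
    log_valq_normalForm_twoInert hq3 hq2 hpq (Or.inl rfl) 0 0 _ _ _ hw, Valuation.map_one, WithZero.log_one] at h11
  have hk := k.isLt; have hl := l.isLt; have hm := m.isLt
  have hk' := k'.isLt; have hl' := l'.isLt; have hm' := m'.isLt
  ext <;> simp only <;> omega

include hp3 hq3 hp2 hq2 hpq in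
/-- **`#δ(A'(K3)) ≤ 27`.** [cite: Jeong2019RankExactlyTwoII, Lemma 3.3] -/
theorem natCard_range_le :
    Nat.card (Set.range (MordellDescent.cubicDescentClass (mordellCurve ((9 * ((3 * (p * q) : ℕ) : K3)) ^ 2))
        (9 * ((3 * (p * q) : ℕ) : K3)))) ≤ 27 := by
  have hbox : Nat.card (Set.range (fun klm : Fin 3 × Fin 3 × Fin 3 =>
      MordellDescent.cubeClass ((2 : K3) ^ (klm.1 : ℕ) * (p : K3) ^ (klm.2.1 : ℕ) * (q : K3) ^ (klm.2.2 : ℕ)))) = 27 := by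
    rw [Nat.card_range_of_injective (box_injective hp3 hq3 hp2 hq2 hpq)]; simp
  rw [← hbox]
  exact Nat.card_mono (Set.toFinite _) (range_subset_box hp3 hq3 hp2 hq2)

include hp3 hq3 hp2 hq2 hpq in
/-- **`rank (Y² = X³ + (27pq)²)(ℚ) ≤ 2`** from the count `#δ(A'(K3)) = 3^{rank + 1} ≤ 27`.
[cite: Jeong2019RankExactlyTwoII, Lemma 3.3 and Prop. 3.5] [cite: SilvermanAEC2009, X.4 Remark X.4.7] -/
theorem mordellWeilRank_le_two' : (mordellCurve (((27 * (p * q) : ℕ) : ℚ) ^ 2)).mordellWeilRank ≤ 2 := by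
  have hc' : (((3 * (p * q) : ℕ) : ℚ) : K3) = ((3 * (p * q) : ℕ) : K3) := by push_cast; ring
  have hσc : conjBar (algebraMap K3 _ ((3 * (p * q) : ℕ) : K3)) = algebraMap K3 _ ((3 * (p * q) : ℕ) : K3) := by
    rw [← hc', conjBar_ratCast]
  have hb : ((27 * (p * q) : ℕ) : ℚ) ≠ 0 := by
    exact_mod_cast (Nat.mul_ne_zero (by norm_num) (Nat.mul_ne_zero hpp.out.ne_zero hqp.out.ne_zero))
  have hbc : algebraMap ℚ K3 ((27 * (p * q) : ℕ) : ℚ) = 9 * ((3 * (p * q) : ℕ) : K3) := by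
    rw [map_natCast]; push_cast; ring
  have hcount := SqrtThree.natCard_range_cubicDescentClass_eq (K := K3) finrank_eq theta_sq conjBar
    conjBar_theta hσc hb hbc
  have hle := natCard_range_le hp3 hq3 hp2 hq2 hpq
  rw [hcount] at hle
  have hle' : 3 ^ ((mordellCurve (((27 * (p * q) : ℕ) : ℚ) ^ 2)).mordellWeilRank + 1) ≤ 3 ^ 3 :=
    hle.trans (by norm_num)
  have := (Nat.pow_le_pow_iff_right (by norm_num : 2 ≤ 3)).mp hle'
  omega

/-- `A_t : y² = x³ + t²` is `ℚ`-isomorphic (`u = 1/3`) to `Y² = X³ + (27t)²`. [cite: SilvermanAEC2009, III.1 (admissible change of variables)] -/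
theorem variableChange_curve' (t : ℚ) :
    (⟨Units.mk0 (1 / 3 : ℚ) (by norm_num), 0, 0, 0⟩ : VariableChange ℚ) • mordellCurve (t ^ 2) =
      mordellCurve ((27 * t) ^ 2) := by
  ext
  · simp [mordellCurve, variableChange_a₁]
  · simp [mordellCurve, variableChange_a₂]
  · simp [mordellCurve, variableChange_a₃]
  · simp [mordellCurve, variableChange_a₄]
  · simp [mordellCurve, variableChange_a₆]
    norm_num; ring

include hp3 hq3 hp2 hq2 hpq in
/-- **`rank A_{pq}(ℚ) ≤ 2` for all distinct odd primes `p, q ≡ 2 (mod 3)`**, `A_{pq} : y² = x³ + (pq)²`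
(unconditional; Jeong obtains it from `Sel_φ ⊆ ⟨2, p, q⟩` and `Sel_{φ'} = 1`). [cite: Jeong2019RankExactlyTwoII, Prop. 3.5] -/
theorem mordellWeilRank_le_two : (mordellCurve (((p * q : ℕ) : ℚ) ^ 2)).mordellWeilRank ≤ 2 := by
  have hMW : ((⟨Units.mk0 (1 / 3 : ℚ) (by norm_num), 0, 0, 0⟩ : VariableChange ℚ) •
      mordellCurve (((p * q : ℕ) : ℚ) ^ 2)).mordellWeilRank = (mordellCurve (((p * q : ℕ) : ℚ) ^ 2)).mordellWeilRank :=
    @WeierstrassCurve.VariableChange.finrank_point_variableChange ℚ _ (mordellCurve (((p * q : ℕ) : ℚ) ^ 2))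
      ⟨Units.mk0 (1 / 3 : ℚ) (by norm_num), 0, 0, 0⟩ (Classical.decEq ℚ)
  rw [variableChange_curve'] at hMW
  rw [← hMW, show (27 : ℚ) * ((p * q : ℕ) : ℚ) = ((27 * (p * q) : ℕ) : ℚ) by push_cast; ring]
  exact mordellWeilRank_le_two' hp3 hq3 hp2 hq2 hpq

include hp3 hq3 hp2 hq2 hpq in
/-- The same bound for the `−3`-twist `E : y² = x³ − 27(pq)²` (`3`-isogenous to `A_{pq}`).
[cite: Jeong2019RankExactlyTwoII, Prop. 3.5] -/
theorem mordellWeilRank_twist_le_two : (mordellCurve (-27 * ((p * q : ℕ) : ℚ) ^ 2)).mordellWeilRank ≤ 2 := by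
  rw [← SqrtThree.quadraticTwist_mordellCurve_sq, SqrtThree.mordellWeilRank_quadraticTwist_neg_three
    (by exact_mod_cast Nat.mul_ne_zero hpp.out.ne_zero hqp.out.ne_zero)]
  exact mordellWeilRank_le_two hp3 hq3 hp2 hq2 hpq

end Rank

/-! ## §4 Sharpness criterion: three descent classes `[2], [p], [q]` ⇒ `Ш[3] = 0` and `rank = 2` -/

section Sharp

variable (hp3 : p % 3 = 2) (hq3 : q % 3 = 2) (hp2 : p ≠ 2) (hq2 : q ≠ 2) (hpq : p ≠ q)
variable
  (h2 : MordellDescent.cubeClass (2 : K3) ∈ Set.range (fun P : (mordellCurve (81 * ((3 * (p * q) : ℕ) : K3) ^ 2)).toAffine.Point =>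
      MordellDescent.cubeClass (MordellDescent.phiDescent ((3 * (p * q) : ℕ) : K3) P)))
  (hgp : MordellDescent.cubeClass (p : K3) ∈ Set.range (fun P : (mordellCurve (81 * ((3 * (p * q) : ℕ) : K3) ^ 2)).toAffine.Point =>
      MordellDescent.cubeClass (MordellDescent.phiDescent ((3 * (p * q) : ℕ) : K3) P)))
  (hgq : MordellDescent.cubeClass (q : K3) ∈ Set.range (fun P : (mordellCurve (81 * ((3 * (p * q) : ℕ) : K3) ^ 2)).toAffine.Point =>
      MordellDescent.cubeClass (MordellDescent.phiDescent ((3 * (p * q) : ℕ) : K3) P)))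

/-- `cubeClass` is multiplicative on powers. [folklore] -/
private theorem cubeClass_pow' {F : Type} [Field F] {a : F} (ha : a ≠ 0) (n : ℕ) :
    MordellDescent.cubeClass (a ^ n) = MordellDescent.cubeClass a ^ n := by
  induction n with
  | zero => rw [pow_zero, pow_zero, MordellDescent.cubeClass_one]
  | succ n ih => rw [pow_succ, pow_succ, MordellDescent.cubeClass_mul (pow_ne_zero _ ha) ha, ih]

include h2 hgp hgq in
/-- With `[2], [p], [q]` among the descent classes, every box class `[2^k p^l q^m]` lies in the subgroup they
generate. [cite: Jeong2019RankExactlyTwoII, §3] -/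
theorem box_mem_closure (k l m : ℕ) :
    MordellDescent.cubeClass (((2 ^ k * p ^ l * q ^ m : ℚ)) : K3) ∈
      Subgroup.closure (Set.range (fun P : (mordellCurve (81 * ((3 * (p * q) : ℕ) : K3) ^ 2)).toAffine.Point =>
        MordellDescent.cubeClass (MordellDescent.phiDescent ((3 * (p * q) : ℕ) : K3) P))) := by
  have hp0 : (p : K3) ≠ 0 := natCast_ne_zero (p := p)
  have hq0 : (q : K3) ≠ 0 := natCast_ne_zero (p := q)
  have hcast : (((2 ^ k * p ^ l * q ^ m : ℚ)) : K3) = (2 : K3) ^ k * (p : K3) ^ l * (q : K3) ^ m := by push_cast; ring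
  rw [hcast, MordellDescent.cubeClass_mul (mul_ne_zero (pow_ne_zero _ two_ne_zero) (pow_ne_zero _ hp0)) (pow_ne_zero _ hq0),
    MordellDescent.cubeClass_mul (pow_ne_zero _ two_ne_zero) (pow_ne_zero _ hp0),
    cubeClass_pow' two_ne_zero, cubeClass_pow' hp0, cubeClass_pow' hq0]
  exact Subgroup.mul_mem _ (Subgroup.mul_mem _ (Subgroup.pow_mem _ (Subgroup.subset_closure h2) k)
    (Subgroup.pow_mem _ (Subgroup.subset_closure hgp) l)) (Subgroup.pow_mem _ (Subgroup.subset_closure hgq) m)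

include hp3 hq3 hp2 hq2 h2 hgp hgq in
/-- **Sharpness ⇒ `Ш(A/K3) ∩ ker [√−3]_* = 0`**: every torsor class in `Ш` has its `[a]` in the box, hence in the
subgroup generated by descent values, hence is trivial (`eq_zero_of_mem_sha_of_galH1Map_eq_zero`).
[cite: CohenPazuki2009, Thm. 2.1] [cite: Jeong2019RankExactlyTwoII, Prop. 3.5] -/
theorem eq_zero_of_mem_sha_of_f (c₀ : (mordellCurve ((((3 * (p * q) : ℕ) : K3) * theta) ^ 2)).galH1)
    (hc₀ : c₀ ∈ (mordellCurve ((((3 * (p * q) : ℕ) : K3) * theta) ^ 2)).sha)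
    (h0 : galH1Map (SqrtThree.sqrtThree (hBA (p := p) (q := q)) theta_sq).toAddMonoidHom
      (SqrtThree.sqrtThree (hBA (p := p) (q := q)) theta_sq).equivariant c₀ = 0) : c₀ = 0 := by
  refine MordellDescent.eq_zero_of_mem_sha_of_galH1Map_eq_zero hc hD (SqrtThree.sqrtThree hBA theta_sq).toAddMonoidHom
    (SqrtThree.sqrtThree hBA theta_sq).equivariant f_surjective f_ker (fun a ha hsha => ?_) hc₀ h0
  obtain ⟨k, l, m, -, -, -, h⟩ := exists_cubeClass_eq_of_sha hp3 hq3 hp2 hq2 ha hsha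
  rw [h]
  exact box_mem_closure h2 hgp hgq k l m

include hp3 hq3 hp2 hq2 h2 hgp hgq in
/-- **Sharpness ⇒ `Ш(A/ℚ(ζ₃))[3] = 0`** (`[√−3]² = −3`). [cite: CohenPazuki2009, Thm. 2.1] -/
theorem forall_mem_sha_three_nsmul_eq_zero :
    ∀ c₀ ∈ (mordellCurve ((((3 * (p * q) : ℕ) : K3) * theta) ^ 2)).sha, 3 • c₀ = 0 → c₀ = 0 := by
  haveI : (mordellCurve ((((3 * (p * q) : ℕ) : K3) * theta) ^ 2)).IsElliptic :=
    isElliptic_mordellCurve (pow_ne_zero 2 hBA)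
  exact forall_mem_sha_nsmul_three_eq_zero_of_ker (SqrtThree.sqrtThree hBA theta_sq) f_comp_self
    (eq_zero_of_mem_sha_of_f hp3 hq3 hp2 hq2 h2 hgp hgq)

omit hpp hqp in
/-- The base change of `E : y² = x³ − 27t²` to `K3` is `A : Y² = X³ + (3tθ)²`. [cite: Jeong2019RankExactlyTwoII, §3] -/
theorem baseChange_twist :
    (mordellCurve (-27 * ((p * q : ℕ) : ℚ) ^ 2)).baseChange K3 = mordellCurve ((((3 * (p * q) : ℕ) : K3) * theta) ^ 2) := by
  rw [mordellCurve_baseChange, mul_pow, theta_sq]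
  congr 1
  simp only [map_mul, map_neg, map_pow, map_natCast, map_ofNat]
  push_cast
  ring

include hp3 hq3 hp2 hq2 h2 hgp hgq in
/-- **Sharpness ⇒ `Ш(E/ℚ)[3] = 0`** for `E : y² = x³ − 27(pq)²` (restriction to `K3` is injective on `Ш[3]`,
`3 ∤ [K3 : ℚ] = 2`). [cite: CohenPazuki2009, Thm. 2.1] [cite: Jeong2019RankExactlyTwoII, Prop. 3.5] -/
theorem forall_mem_sha_three_nsmul_eq_zero_rat :
    ∀ c₀ ∈ (mordellCurve (-27 * ((p * q : ℕ) : ℚ) ^ 2)).sha, 3 • c₀ = 0 → c₀ = 0 := by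
  haveI : (mordellCurve (-27 * ((p * q : ℕ) : ℚ) ^ 2)).IsElliptic :=
    isElliptic_mordellCurve (mul_ne_zero (by norm_num) (pow_ne_zero 2
      (by exact_mod_cast Nat.mul_ne_zero hpp.out.ne_zero hqp.out.ne_zero)))
  haveI : IsGalois ℚ K3 := IsCyclotomicExtension.isGalois {3} ℚ K3
  intro c₀ hc₀ h3
  have key : ∀ d ∈ ((mordellCurve (-27 * ((p * q : ℕ) : ℚ) ^ 2)).baseChange K3).sha, 3 • d = 0 → d = 0 := by
    rw [baseChange_twist]
    exact forall_mem_sha_three_nsmul_eq_zero hp3 hq3 hp2 hq2 h2 hgp hgq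
  set c' : (mordellCurve (-27 * ((p * q : ℕ) : ℚ) ^ 2)).sha := ⟨c₀, hc₀⟩ with hc'
  have h3' : 3 • c' = 0 := Subtype.ext h3
  have hres : shaRestriction (mordellCurve (-27 * ((p * q : ℕ) : ℚ) ^ 2)) K3 c' = 0 := by
    apply Subtype.ext
    apply key _ (shaRestriction (mordellCurve (-27 * ((p * q : ℕ) : ℚ) ^ 2)) K3 c').2
    rw [← AddSubgroupClass.coe_nsmul, ← map_nsmul, h3', map_zero]
    rfl
  have hcop : Nat.Coprime 3 (Module.finrank ℚ K3) := by rw [finrank_eq]; decide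
  exact congrArg Subtype.val
    ((shaRestriction_eq_zero_iff_of_coprime (mordellCurve (-27 * ((p * q : ℕ) : ℚ) ^ 2)) K3 hcop c' h3').mp hres)

include hp3 hq3 hp2 hq2 h2 hgp hgq in
/-- **Sharpness ⇒ `corank_{ℤ₃} Ш(E/ℚ)[3^∞] = 0` and `Ш(E/ℚ)[3^∞] = 0`** for `E : y² = x³ − 27(pq)²`.
[cite: Greenberg1999LNM, §1] -/
theorem shaCorank_three_eq_zero :
    (mordellCurve (-27 * ((p * q : ℕ) : ℚ) ^ 2)).shaCorank 3 = 0 ∧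
      AddCommGroup.primaryComponent (mordellCurve (-27 * ((p * q : ℕ) : ℚ) ^ 2)).sha 3 = ⊥ :=
  haveI : Fact (Nat.Prime 3) := ⟨Nat.prime_three⟩
  ⟨shaCorank_eq_zero_of_forall _ 3 (forall_mem_sha_three_nsmul_eq_zero_rat hp3 hq3 hp2 hq2 h2 hgp hgq),
    primaryComponent_sha_eq_bot_of_forall _ (forall_mem_sha_three_nsmul_eq_zero_rat hp3 hq3 hp2 hq2 h2 hgp hgq)⟩

/-- The descent classes form a subgroup of `K3ˣ/K3ˣ³`. [cite: SilvermanAEC2009, X.4 Remark X.4.7] -/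
theorem exists_subgroup_range :
    ∃ H : Subgroup (MordellDescent.CubeUnits K3),
      (H : Set (MordellDescent.CubeUnits K3)) =
        Set.range (MordellDescent.cubicDescentClass (mordellCurve ((9 * ((3 * (p * q) : ℕ) : K3)) ^ 2))
          (9 * ((3 * (p * q) : ℕ) : K3))) := by
  have h9 : (9 : K3) * ((3 * (p * q) : ℕ) : K3) ≠ 0 := mul_ne_zero (by norm_num) hc
  refine ⟨{ carrier := Set.range (MordellDescent.cubicDescentClass (mordellCurve ((9 * ((3 * (p * q) : ℕ) : K3)) ^ 2))
              (9 * ((3 * (p * q) : ℕ) : K3)))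
            mul_mem' := ?_, one_mem' := ⟨0, MordellDescent.cubicDescentClass_zero _⟩, inv_mem' := ?_ }, rfl⟩
  · rintro _ _ ⟨P, rfl⟩ ⟨Q, rfl⟩
    exact ⟨_, MordellDescent.cubicDescentClass_add rfl two_ne_zero h9 P Q⟩
  · rintro _ ⟨P, rfl⟩
    exact ⟨_, eq_inv_of_mul_eq_one_left (MordellDescent.cubicDescentClass_neg_mul rfl two_ne_zero h9 P)⟩

include h2 hgp hgq in
/-- With the three generators present, the whole box consists of descent classes. [cite: Jeong2019RankExactlyTwoII, §3] -/
theorem box_subset_range :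
    Set.range (fun klm : Fin 3 × Fin 3 × Fin 3 =>
        MordellDescent.cubeClass ((2 : K3) ^ (klm.1 : ℕ) * (p : K3) ^ (klm.2.1 : ℕ) * (q : K3) ^ (klm.2.2 : ℕ))) ⊆
      Set.range (MordellDescent.cubicDescentClass (mordellCurve ((9 * ((3 * (p * q) : ℕ) : K3)) ^ 2))
        (9 * ((3 * (p * q) : ℕ) : K3))) := by
  obtain ⟨H, hH⟩ := exists_subgroup_range (p := p) (q := q)
  rintro _ ⟨⟨k, l, m⟩, rfl⟩
  have hmem := box_mem_closure h2 hgp hgq (k : ℕ) (l : ℕ) (m : ℕ)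
  rw [show (((2 ^ (k : ℕ) * p ^ (l : ℕ) * q ^ (m : ℕ) : ℚ)) : K3) =
      (2 : K3) ^ (k : ℕ) * (p : K3) ^ (l : ℕ) * (q : K3) ^ (m : ℕ) by push_cast; ring, range_eq_range, ← hH] at hmem
  rw [← hH]
  exact (Subgroup.closure_le H).mpr (fun x hx => hx) hmem

include hp3 hq3 hp2 hq2 hpq h2 hgp hgq in
/-- **Sharpness ⇒ `rank A_{pq}(ℚ) = 2` and `rank (y² = x³ − 27(pq)²)(ℚ) = 2` exactly.**
[cite: Jeong2019RankExactlyTwoII, Prop. 3.5] -/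
theorem mordellWeilRank_eq_two :
    (mordellCurve (((p * q : ℕ) : ℚ) ^ 2)).mordellWeilRank = 2 ∧
      (mordellCurve (-27 * ((p * q : ℕ) : ℚ) ^ 2)).mordellWeilRank = 2 := by
  -- the descent image is exactly the box: `27` elements
  have hcard : Nat.card (Set.range (MordellDescent.cubicDescentClass
      (mordellCurve ((9 * ((3 * (p * q) : ℕ) : K3)) ^ 2)) (9 * ((3 * (p * q) : ℕ) : K3)))) = 27 := by
    rw [Set.Subset.antisymm (range_subset_box hp3 hq3 hp2 hq2) (box_subset_range h2 hgp hgq),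
      Nat.card_range_of_injective (box_injective hp3 hq3 hp2 hq2 hpq)]
    simp
  have hc' : (((3 * (p * q) : ℕ) : ℚ) : K3) = ((3 * (p * q) : ℕ) : K3) := by push_cast; ring
  have hσc : conjBar (algebraMap K3 _ ((3 * (p * q) : ℕ) : K3)) = algebraMap K3 _ ((3 * (p * q) : ℕ) : K3) := by
    rw [← hc', conjBar_ratCast]
  have hpq0 : ((p * q : ℕ) : ℚ) ≠ 0 := by exact_mod_cast Nat.mul_ne_zero hpp.out.ne_zero hqp.out.ne_zero
  have hb : ((27 * (p * q) : ℕ) : ℚ) ≠ 0 := by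
    exact_mod_cast (Nat.mul_ne_zero (by norm_num) (Nat.mul_ne_zero hpp.out.ne_zero hqp.out.ne_zero))
  have hbc : algebraMap ℚ K3 ((27 * (p * q) : ℕ) : ℚ) = 9 * ((3 * (p * q) : ℕ) : K3) := by
    rw [map_natCast]; push_cast; ring
  have hcount := SqrtThree.natCard_range_cubicDescentClass_eq (K := K3) finrank_eq theta_sq conjBar
    conjBar_theta hσc hb hbc
  rw [hcard] at hcount
  have h27 : 3 ^ 3 = 3 ^ ((mordellCurve (((27 * (p * q) : ℕ) : ℚ) ^ 2)).mordellWeilRank + 1) :=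
    (show (3 : ℕ) ^ 3 = 27 by norm_num).trans hcount
  have hr' : (mordellCurve (((27 * (p * q) : ℕ) : ℚ) ^ 2)).mordellWeilRank = 2 := by
    have := Nat.pow_right_injective (by norm_num : 2 ≤ 3) h27
    omega
  -- transport to `A_t` (`u = 1/3`) and to the twist (`3`-isogeny)
  have hMW : ((⟨Units.mk0 (1 / 3 : ℚ) (by norm_num), 0, 0, 0⟩ : VariableChange ℚ) •
      mordellCurve (((p * q : ℕ) : ℚ) ^ 2)).mordellWeilRank = (mordellCurve (((p * q : ℕ) : ℚ) ^ 2)).mordellWeilRank :=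
    @WeierstrassCurve.VariableChange.finrank_point_variableChange ℚ _ (mordellCurve (((p * q : ℕ) : ℚ) ^ 2))
      ⟨Units.mk0 (1 / 3 : ℚ) (by norm_num), 0, 0, 0⟩ (Classical.decEq ℚ)
  rw [variableChange_curve', show (27 : ℚ) * ((p * q : ℕ) : ℚ) = ((27 * (p * q) : ℕ) : ℚ) by push_cast; ring, hr'] at hMW
  refine ⟨hMW.symm, ?_⟩
  rw [← SqrtThree.quadraticTwist_mordellCurve_sq, SqrtThree.mordellWeilRank_quadraticTwist_neg_three hpq0, ← hMW]

include hp3 hq3 hp2 hq2 hpq h2 hgp hgq in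
/-- **Sharpness ⇒ the door at `3` at rank `2`**: `E : y² = x³ − 27(pq)²` has `rank E(ℚ) = 2`, `t_3(E) = 0`,
`Ш(E/ℚ)[3^∞] = 0` and `corank_{ℤ₃} Sel_{3^∞}(E/ℚ) = 2`. [cite: Jeong2019RankExactlyTwoII, Prop. 3.5] [cite: Greenberg1999LNM, §1] -/
theorem door_at_three_of_generators :
    (mordellCurve (-27 * ((p * q : ℕ) : ℚ) ^ 2)).mordellWeilRank = 2 ∧
      (mordellCurve (-27 * ((p * q : ℕ) : ℚ) ^ 2)).shaCorank 3 = 0 ∧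
      AddCommGroup.primaryComponent (mordellCurve (-27 * ((p * q : ℕ) : ℚ) ^ 2)).sha 3 = ⊥ ∧
      (mordellCurve (-27 * ((p * q : ℕ) : ℚ) ^ 2)).selmerCorank 3 = 2 := by
  haveI : (mordellCurve (-27 * ((p * q : ℕ) : ℚ) ^ 2)).IsElliptic :=
    isElliptic_mordellCurve (mul_ne_zero (by norm_num) (pow_ne_zero 2
      (by exact_mod_cast Nat.mul_ne_zero hpp.out.ne_zero hqp.out.ne_zero)))
  haveI : Fact (Nat.Prime 3) := ⟨Nat.prime_three⟩
  obtain ⟨-, hr⟩ := mordellWeilRank_eq_two hp3 hq3 hp2 hq2 hpq h2 hgp hgq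
  obtain ⟨hsha, hprim⟩ := shaCorank_three_eq_zero hp3 hq3 hp2 hq2 h2 hgp hgq
  refine ⟨hr, hsha, hprim, ?_⟩
  rw [(mordellCurve (-27 * ((p * q : ℕ) : ℚ) ^ 2)).selmerCorank_eq_mordellWeilRank_add_holds 3, hr, hsha]

end Sharp

end MordellPQ

end Literature.NumberTheory.EllipticCurves
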